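import Summits.BirchSwinnertonDyer.BirchSwinnertonDyer.Theorems.AlignedTransportAtTwoMainConjectureOfRankZeroBSDAtTwoHalfDescentLayerIndexGrowthFiniteCell
import Literature.NumberTheory.EllipticCurves.SubgroupSelmerCorestrictionProofs
import Literature.NumberTheory.EllipticCurves.SelmerLayerRestrictionInjectiveProofs
import Summits.BirchSwinnertonDyer.BirchSwinnertonDyer.Theorems.ByReductionTypeAtTwoTowerCorankBoundOfFaithfulParts
import HarnessLib

/-!
# Route `AlignedTransportAtTwo`, crux C2 `MainConjectureOfRankZeroBSDAtTwo` (stmt-BirchSwinnertonDyer-22298):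
# THE TWIST READING OF THE MINUS PART, I — THE PLUS PART IS THE LOWER LAYER: for EVERY layer `K_{n+1}/K_n` of a `ℤ_p`-extension,
# `res(Sel_{p^∞}(E/K_n)) ≤ Sel⁺_{n+1} := Sel_{p^∞}(E/K_{n+1}) ∩ ker(conj_g − 1)` (`g = γ^{pⁿ}`), `p·Sel⁺_{n+1} ≤ res(Sel_{p^∞}(E/K_n))` (corestriction),
# `#Sel_{n+1} = #Sel⁺_{n+1} · #I_{n+1}` (`I_{n+1} = (g − 1)Sel_{n+1}`, gen 57's finite-level avatar of the growth number); hence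
# `#Sel_n · #I_{n+1} ∣ #Sel_{n+1} · #(ker res ∩ Sel_n)` and `#Sel_{n+1} ∣ #Sel_n · #I_{n+1} · #Sel⁺_{n+1}[p]`, SHARP on the seed cell `E(K)[p] = 0`

HONEST FRAMING (cell `bsd-f1-sign2`, WIDTH-5 attached prover seat `bsd-line-att-p5` gen 58 on line `birth` of the lead `bsd-line-att-p2`;
`--supports` stmt-BirchSwinnertonDyer-22298, closes nothing; BSD is NOT proved by any of this; the crux C2, its verdict «blocked-on
`Rank1Residual.GreenbergMuConjectureIrreducible`» and every registered stub (P / T / Kμ / LimDoor / MuIneqʳ / PFμ⁺) are untouched). THEOREMS ONLY — no `def`,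
no instance, no named fact, no `sorry`. Route-independent (any number field `K`, any prime `p`, any `ℤ_p`-extension `κ` with topological generator `γ`,
any Pontryagin-dual datum). Sequel of gen 57's `…HalfDescentLayerIndexGrowthFinite{,Two,Cell}` («the growth number at finite level»: the image
`I_{n+1} = (conj_g − 1)·Sel_{p^∞}(E/K_{n+1})` and, at `p = 2`, the minus part / norm kernel `M_{n+1} = Sel_{n+1} ∩ ker(conj_g + 1)` carry the growth number
`g_n = #(ω_nX/ω_{n+1}X)` up to Greenberg's control kernel). Lineage glue on gen 57's successor (i) «the twist reading of the minus part», first half: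
the PLUS part. The companion `…GrowthFiniteTwistMinus` identifies the MINUS part with the Selmer group of the quadratic twist one layer down.

THE POINT. `σ = conj_g` is an endomorphism of `X = H¹(K_{n+1}, E[p^∞])` stabilising `S = Sel_{n+1}`; `0 → S⁺ → S → (σ − 1)S → 0` with `S⁺ = S ∩ ker(σ − 1)`
gives `#S = #S⁺ · #I` (§1, any abelian group). The restriction `r = res_{K_n → K_{n+1}}` lands in the `σ`-fixed classes (`σ` acts trivially on `H¹(K_n, ·)`
because `g ∈ Gal(K̄/K_n)`: tree `conjH1_of_mem`, `resOfLe_comp_conjH1`) and carries `Sel_n` into `Sel_{n+1}` (tree `resOfLe_mem_selmerLayer`), so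
`r(Sel_n) ≤ S⁺`; conversely the corestriction `cor = cor_{K_{n+1}/K_n}` (tree `coresLayer`, `coresLayer_mem_selmerLayer`) has `r ∘ cor = Σ_{i<p} conj_{g^i}`
(the tree's `TowerCorank.resOfLe_coresLayer_eq_sum`, `…_eq_nsmul_of_conjH1_eq`), which is multiplication by `p` on `σ`-fixed classes: `p·S⁺ ≤ r(Sel_n)`.
* §1 (abelian groups) `natCard_eq_natCard_map_mul_natCard_ker_inf` (`#T = #f(T)·#(ker f ∩ T)`), ★ `natCard_eq_natCard_inf_ker_mul_natCard_map`
  (**`#S = #(S ∩ ker(σ − 1)) · #((σ − 1)S)`**), `inf_ker_add_inf_torsionBy_eq` (**`(S ∩ ker(σ + 1))[2] = (S ∩ ker(σ − 1))[2]`** — on `2`-torsion classes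
  the minus part IS the plus part), `natCard_dvd_mul_natCard_inf_torsionBy` (`n·M ⊆ J ⟹ #M ∣ #J · #M[n]`).
* §2 (Selmer, any `p`) `conjH1_resOfLe_layer_eq`, ★★ `map_resOfLe_selmerLayer_le_inf_ker` (**`r(Sel_n) ≤ Sel⁺_{n+1}`**), ★★ `nsmul_mem_map_resOfLe_selmerLayer` (**`p·Sel⁺_{n+1} ≤ r(Sel_n)`**),
  `natCard_selmerLayer_succ_eq_mul` (**`#Sel_{n+1} = #Sel⁺_{n+1} · #I_{n+1}`**), ★★ `natCard_selmerLayer_mul_dvd` (**`#Sel_n · #I_{n+1} ∣ #Sel_{n+1} · #(ker r ∩ Sel_n)`**),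
  ★★ `natCard_selmerLayer_succ_dvd` (**`#Sel_{n+1} ∣ #Sel_n · #I_{n+1} · #Sel⁺_{n+1}[p]`**) — no hypothesis.
* §3 (the seed cell `E(K)[p] = 0`: `r` is injective, tree `resOfLe_layer_injective`) ★★★ `natCard_selmerLayer_mul_dvd_and_dvd_of_noTorsion`:
  **`#Sel_n · #I_{n+1} ∣ #Sel_{n+1} ∣ #Sel_n · #I_{n+1} · #Sel⁺_{n+1}[p]`** — the growth number's finite-level avatar `#I_{n+1}` (gen 57: `#I_{n+1} ∣ g_n ∣
  #I_{n+1} · #ker g_{n+1}` on the cell) is the LAYER RATIO `#Sel_{n+1}/#Sel_n` up to the `p`-torsion of the plus part; and the ratio door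
  `mu_eq_zero_of_natCard_selmerLayer_succ_mul_kerG_lt_mul_of_noTorsion` (**`0 < #Sel_{n+1}·#ker g_{n+1} < p^{pⁿ(p−1)}·#Sel_n ⟹ μ = 0`**, a sibling of gen 56's
  `…GrowthSelmer` §3 through the plus part instead of the limit invariants).
What is NOT claimed: nothing about any curve; no Selmer group computed; C2 untouched. Memo `Cruxes/MainConjectureOfRankZeroBSDAtTwo/TWIST-READING-att-p5-g58.md`.

References: J.-P. Serre, *Galois Cohomology* (1997), I.§2.4 (res, cor, `cor ∘ res = n`), I.§2.5 [SerreGaloisCohomology1997]; R. Greenberg, LNM 1716 (1999), §1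
pp. 60–65, §3 Lemmas 3.1–3.3, §4 Lemma 4.3 [GreenbergLNM1716]; T. Dokchitser, V. Dokchitser, Ann. of Math. 172 (2010), Lemma 4.14 (proof) [DokchitserDokchitserAnnals2010];
B. Mazur, Invent. Math. 18 (1972) §6 [Mazur1972]; J. Neukirch, A. Schmidt, K. Wingberg, *Cohomology of Number Fields*, I.§5 [NeukirchSchmidtWingberg2008].
-/

set_option linter.dupNamespace false
set_option autoImplicit false

noncomputable section

open scoped Classical AddSubgroup Polynomial

universe u

namespace Summit.BirchSwinnertonDyer.BirchSwinnertonDyer.Theorems.AlignedTransportAtTwoHalfDescentLayerIndexGrowthFiniteTwist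

open WeierstrassCurve Literature.NumberTheory.EllipticCurves Literature.NumberTheory.EllipticCurves.IwasawaDual
  Literature.NumberTheory.EllipticCurves.IwasawaAlgebra
  Summit.BirchSwinnertonDyer.Rank1Residual.X1.MuLambda
  Summit.BirchSwinnertonDyer.Rank1Residual.Iwasawa
  Summit.BirchSwinnertonDyer.BirchSwinnertonDyer.Theorems
  Summit.BirchSwinnertonDyer.BirchSwinnertonDyer.Theorems.AlignedTransportAtTwoHalfDescentLayerIndexGrowthFinite
  Summit.BirchSwinnertonDyer.BirchSwinnertonDyer.Theorems.AlignedTransportAtTwoHalfDescentLayerIndexGrowthFiniteCell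

/-! ## §1 Abelian groups: `#S = #S⁺ · #I`, `M[2] = S⁺[2]`, and `n·M ⊆ J ⟹ #M ∣ #J · #M[n]` -/

section Abstract

variable {A X : Type*} [AddCommGroup A] [AddCommGroup X]

/-- `#T = #f(T) · #(ker f ∩ T)` for a homomorphism `f : A → X` and a subgroup `T ≤ A` (first isomorphism theorem for `f|_T`; `Nat.card`, no finiteness needed).
[folklore] -/
theorem natCard_eq_natCard_map_mul_natCard_ker_inf (f : A →+ X) (T : AddSubgroup A) :
    Nat.card T = Nat.card ↥(T.map f) * Nat.card ↥(f.ker ⊓ T) := by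
  set t : ↥T →+ X := f.comp T.subtype with ht
  have hrange : t.range = T.map f := by rw [ht, AddMonoidHom.range_comp, AddSubgroup.range_subtype]
  have hker : Nat.card t.ker = Nat.card ↥(f.ker ⊓ T) := by
    have e : t.ker = (f.ker ⊓ T).addSubgroupOf T := by
      ext x
      rw [AddMonoidHom.mem_ker, AddSubgroup.mem_addSubgroupOf, AddSubgroup.mem_inf, AddMonoidHom.mem_ker, ht,
        AddMonoidHom.comp_apply, AddSubgroup.coe_subtype]
      exact ⟨fun hx ↦ ⟨hx, x.2⟩, fun hx ↦ hx.1⟩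
    rw [e]
    exact Nat.card_congr (AddSubgroup.addSubgroupOfEquivOfLe inf_le_right).toEquiv
  rw [AddSubgroup.card_eq_card_quotient_mul_card_addSubgroup t.ker, Nat.card_congr (QuotientAddGroup.quotientKerEquivRange t).toEquiv,
    hrange, hker]

variable (σ : X →+ X) (S : AddSubgroup X)

/-- ★ **`#S = #(S ∩ ker(σ − 1)) · #((σ − 1)·S)`** for any endomorphism `σ` and any subgroup `S` (`0 → S⁺ → S → (σ − 1)S → 0`; `Nat.card`). [folklore] -/
theorem natCard_eq_natCard_inf_ker_mul_natCard_map :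
    Nat.card S = Nat.card ↥(S ⊓ (σ - AddMonoidHom.id X).ker) * Nat.card ↥(S.map (σ - AddMonoidHom.id X)) := by
  rw [natCard_eq_natCard_map_mul_natCard_ker_inf (σ - AddMonoidHom.id X) S, mul_comm, inf_comm]

/-- **`(S ∩ ker(σ + 1)) ∩ X[2] = (S ∩ ker(σ − 1)) ∩ X[2]`**: on classes killed by `2` the conditions `σc = −c` and `σc = c` coincide — the `2`-torsion of the
minus part is the `2`-torsion of the plus part. [folklore] -/
theorem inf_ker_add_inf_torsionBy_eq :
    S ⊓ (σ + AddMonoidHom.id X).ker ⊓ AddSubgroup.torsionBy X 2 = S ⊓ (σ - AddMonoidHom.id X).ker ⊓ AddSubgroup.torsionBy X 2 := by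
  ext x
  have key : (2 : ℕ) • x = 0 → (σ x + x = 0 ↔ σ x - x = 0) := fun h2 ↦ by
    have hneg : -x = x := by
      rw [neg_eq_iff_add_eq_zero, ← two_nsmul]
      exact h2
    rw [sub_eq_add_neg, hneg]
  simp only [AddSubgroup.mem_inf, AddMonoidHom.mem_ker, AddMonoidHom.add_apply, AddMonoidHom.sub_apply, AddMonoidHom.id_apply]
  constructor
  · rintro ⟨⟨hS, hσ⟩, h2⟩
    exact ⟨⟨hS, (key ((AddSubgroup.torsionBy.nsmul_iff (A := X) (n := 2)).mp h2)).mp hσ⟩, h2⟩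
  · rintro ⟨⟨hS, hσ⟩, h2⟩
    exact ⟨⟨hS, (key ((AddSubgroup.torsionBy.nsmul_iff (A := X) (n := 2)).mp h2)).mpr hσ⟩, h2⟩

/-- **`n·M ⊆ J ⟹ #M ∣ #J · #(M ∩ X[n])`**: multiplication by `n` maps `M` into `J` with kernel `M[n]` (`Nat.card`). [folklore] -/
theorem natCard_dvd_mul_natCard_inf_torsionBy (J M : AddSubgroup X) (n : ℕ) (h : ∀ m ∈ M, n • m ∈ J) :
    Nat.card M ∣ Nat.card J * Nat.card ↥(M ⊓ AddSubgroup.torsionBy X n) := by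
  set d : ↥M →+ X := (n • AddMonoidHom.id X).comp M.subtype with hd
  have hd_apply : ∀ c : ↥M, d c = n • (c : X) := fun c ↦ rfl
  have hrange : d.range ≤ J := by
    rintro _ ⟨c, rfl⟩
    rw [hd_apply]
    exact h c c.2
  have hker : Nat.card d.ker = Nat.card ↥(M ⊓ AddSubgroup.torsionBy X n) := by
    have hmem : ∀ c : ↥M, c ∈ d.ker ↔ (c : X) ∈ AddSubgroup.torsionBy X n := fun c ↦ by
      rw [AddMonoidHom.mem_ker, hd_apply]
      exact (AddSubgroup.torsionBy.nsmul_iff (A := X) (n := n)).symm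
    refine Nat.card_congr ⟨fun c ↦ ⟨(c.1 : X), AddSubgroup.mem_inf.mpr ⟨c.1.2, (hmem c.1).mp c.2⟩⟩,
      fun x ↦ ⟨⟨x.1, (AddSubgroup.mem_inf.mp x.2).1⟩, (hmem _).mpr (AddSubgroup.mem_inf.mp x.2).2⟩, fun _ ↦ rfl, fun _ ↦ rfl⟩
  have hsplit : Nat.card ↥M = Nat.card d.range * Nat.card d.ker := by
    rw [AddSubgroup.card_eq_card_quotient_mul_card_addSubgroup d.ker, Nat.card_congr (QuotientAddGroup.quotientKerEquivRange d).toEquiv]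
  rw [hsplit, hker]
  exact mul_dvd_mul_right (AddSubgroup.card_dvd_of_le hrange) _

/-- The case `n = 2` of `natCard_dvd_mul_natCard_inf_torsionBy`, with the literal `X[2]`: **`2·M ⊆ J ⟹ #M ∣ #J · #(M ∩ X[2])`**. [folklore] -/
theorem natCard_dvd_mul_natCard_inf_torsionBy_two (J M : AddSubgroup X) (h : ∀ m ∈ M, (2 : ℕ) • m ∈ J) :
    Nat.card M ∣ Nat.card J * Nat.card ↥(M ⊓ AddSubgroup.torsionBy X 2) :=
  natCard_dvd_mul_natCard_inf_torsionBy J M 2 h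

end Abstract

/-! ## §2 The plus part at EVERY layer: `r(Sel_n) ≤ Sel⁺_{n+1}`, `p·Sel⁺_{n+1} ≤ r(Sel_n)`, `#Sel_{n+1} = #Sel⁺_{n+1} · #I_{n+1}` -/

section Selmer

variable {K : Type u} [Field K] [NumberField K] (W : WeierstrassCurve K) {p : ℕ} [hp : Fact p.Prime] (κ : ZpExtension K p)
  {γ : Field.absoluteGaloisGroup K}

omit [NumberField K] in
/-- **Conjugation by `g ∈ Gal(K̄/K_n)` is trivial on classes restricted from `K_n`**: `conj_g(res c) = res(conj_g c) = res c` on `H¹(K_{n+1}, E[p^∞])`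
(tree `resOfLe_comp_conjH1`, `conjH1_of_mem`). [cite: SerreLocalFields1979, VII.§5 Prop. 3] [cite: NeukirchSchmidtWingberg2008, I.§5] -/
theorem conjH1_resOfLe_layer_eq {n : ℕ} {g : Field.absoluteGaloisGroup K} (hg : g ∈ κ.layerSubgroup n) (x : W.subgroupH1 p (κ.layerSubgroup n)) :
    W.conjH1 p (κ.layerSubgroup (n + 1)) g (W.resOfLe p (κ.layerSubgroup_antitone (Nat.le_succ n)) x) =
      W.resOfLe p (κ.layerSubgroup_antitone (Nat.le_succ n)) x := by
  have hcomm := congrArg (fun f ↦ f x)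
    (resOfLe_comp_conjH1_holds (M := geomPrimaryTorsion W p) (κ.layerSubgroup_antitone (Nat.le_succ n)) g)
  simp only [AddMonoidHom.coe_comp, Function.comp_apply] at hcomm
  have hid : W.conjH1 p (κ.layerSubgroup n) g = AddMonoidHom.id _ := W.conjH1_of_mem_holds p (κ.layerSubgroup n) hg
  rw [← hcomm]
  change W.resOfLe p (κ.layerSubgroup_antitone (Nat.le_succ n)) (W.conjH1 p (κ.layerSubgroup n) g x) = _
  rw [hid, AddMonoidHom.id_apply]

/-- ★★ **`res(Sel_{p^∞}(E/K_n)) ≤ Sel⁺_{n+1} := Sel_{p^∞}(E/K_{n+1}) ∩ ker(conj_{γ^{pⁿ}} − 1)`** — restriction carries `Sel_n` into `Sel_{n+1}` (tree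
`resOfLe_mem_selmerLayer`) and restricted classes are fixed by `Gal(K_{n+1}/K_n) = ⟨γ^{pⁿ}⟩`. No hypothesis. [cite: GreenbergLNM1716, §1 p. 60, §3 Lemma 3.1]
[cite: SerreGaloisCohomology1997, I.§2.5] -/
theorem map_resOfLe_selmerLayer_le_inf_ker (hγ : κ.IsTopGenerator γ) (n : ℕ) :
    (W.selmerLayer κ n).map (W.resOfLe p (κ.layerSubgroup_antitone (Nat.le_succ n))) ≤
      W.selmerLayer κ (n + 1) ⊓
        (W.conjH1 p (κ.layerSubgroup (n + 1)) (γ ^ p ^ n) - AddMonoidHom.id (W.subgroupH1 p (κ.layerSubgroup (n + 1)))).ker := by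
  rintro _ ⟨c, hc, rfl⟩
  refine AddSubgroup.mem_inf.mpr ⟨W.resOfLe_mem_selmerLayer κ (Nat.le_succ n) hc, ?_⟩
  rw [AddMonoidHom.mem_ker, AddMonoidHom.sub_apply, AddMonoidHom.id_apply, sub_eq_zero]
  exact conjH1_resOfLe_layer_eq W κ (κ.pow_mem_layerSubgroup hγ n) c

/-- ★★ **`p · Sel⁺_{n+1} ≤ res(Sel_{p^∞}(E/K_n))`**: for `c ∈ Sel_{n+1}` fixed by `conj_{γ^{pⁿ}}`, `cor c ∈ Sel_n` (tree `coresLayer_mem_selmerLayer`) and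
`res(cor c) = Σ_{i<p} conj_{γ^{pⁿ i}} c = p·c` (tree `TowerCorank.resOfLe_coresLayer_eq_nsmul_of_conjH1_eq`). No hypothesis. [cite: SerreGaloisCohomology1997, I.§2.4 Prop. 9] [cite: DokchitserDokchitserAnnals2010, Lemma 4.14 (proof)] -/
theorem nsmul_mem_map_resOfLe_selmerLayer (hγ : κ.IsTopGenerator γ) (n : ℕ) {c : W.subgroupH1 p (κ.layerSubgroup (n + 1))}
    (hc : c ∈ W.selmerLayer κ (n + 1) ⊓
      (W.conjH1 p (κ.layerSubgroup (n + 1)) (γ ^ p ^ n) - AddMonoidHom.id (W.subgroupH1 p (κ.layerSubgroup (n + 1)))).ker) :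
    p • c ∈ (W.selmerLayer κ n).map (W.resOfLe p (κ.layerSubgroup_antitone (Nat.le_succ n))) := by
  obtain ⟨hcS, hcσ⟩ := AddSubgroup.mem_inf.mp hc
  have hfix : W.conjH1 p (κ.layerSubgroup (n + 1)) (γ ^ p ^ n) c = c := by
    rw [AddMonoidHom.mem_ker, AddMonoidHom.sub_apply, AddMonoidHom.id_apply, sub_eq_zero] at hcσ
    exact hcσ
  exact ⟨W.coresLayer p κ n c, W.coresLayer_mem_selmerLayer p κ n hcS, TowerCorank.resOfLe_coresLayer_eq_nsmul_of_conjH1_eq W p κ hγ n c hfix⟩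

/-- `#res(Sel_n) ∣ #Sel⁺_{n+1}`. [cite: GreenbergLNM1716, §3 Lemma 3.1] -/
theorem natCard_map_resOfLe_selmerLayer_dvd (hγ : κ.IsTopGenerator γ) (n : ℕ) :
    Nat.card ↥((W.selmerLayer κ n).map (W.resOfLe p (κ.layerSubgroup_antitone (Nat.le_succ n)))) ∣
      Nat.card ↥(W.selmerLayer κ (n + 1) ⊓
        (W.conjH1 p (κ.layerSubgroup (n + 1)) (γ ^ p ^ n) - AddMonoidHom.id (W.subgroupH1 p (κ.layerSubgroup (n + 1)))).ker) :=
  AddSubgroup.card_dvd_of_le (map_resOfLe_selmerLayer_le_inf_ker W κ hγ n)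

/-- ★ **`#Sel⁺_{n+1} ∣ #res(Sel_n) · #(Sel⁺_{n+1} ∩ H¹(K_{n+1}, E[p^∞])[p])`** (`p·Sel⁺ ≤ res(Sel_n) ≤ Sel⁺`). No hypothesis.
[cite: DokchitserDokchitserAnnals2010, Lemma 4.14 (proof)] -/
theorem natCard_inf_ker_sub_dvd_mul (hγ : κ.IsTopGenerator γ) (n : ℕ) :
    Nat.card ↥(W.selmerLayer κ (n + 1) ⊓
        (W.conjH1 p (κ.layerSubgroup (n + 1)) (γ ^ p ^ n) - AddMonoidHom.id (W.subgroupH1 p (κ.layerSubgroup (n + 1)))).ker) ∣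
      Nat.card ↥((W.selmerLayer κ n).map (W.resOfLe p (κ.layerSubgroup_antitone (Nat.le_succ n)))) *
        Nat.card ↥(W.selmerLayer κ (n + 1) ⊓
            (W.conjH1 p (κ.layerSubgroup (n + 1)) (γ ^ p ^ n) - AddMonoidHom.id (W.subgroupH1 p (κ.layerSubgroup (n + 1)))).ker ⊓
          AddSubgroup.torsionBy (W.subgroupH1 p (κ.layerSubgroup (n + 1))) p) :=
  natCard_dvd_mul_natCard_inf_torsionBy _ _ p fun _ hm ↦ nsmul_mem_map_resOfLe_selmerLayer W κ hγ n hm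

/-- `#Sel_n = #res(Sel_n) · #(ker res ∩ Sel_n)`. [folklore] -/
theorem natCard_selmerLayer_eq_mul (n : ℕ) :
    Nat.card (W.selmerLayer κ n) =
      Nat.card ↥((W.selmerLayer κ n).map (W.resOfLe p (κ.layerSubgroup_antitone (Nat.le_succ n)))) *
        Nat.card ↥((W.resOfLe p (κ.layerSubgroup_antitone (Nat.le_succ n))).ker ⊓ W.selmerLayer κ n) :=
  natCard_eq_natCard_map_mul_natCard_ker_inf _ _

/-- ★★ **`#Sel_{p^∞}(E/K_{n+1}) = #Sel⁺_{n+1} · #I_{n+1}`** (`I_{n+1} = (conj_{γ^{pⁿ}} − 1)·Sel_{n+1}`, gen 57's finite-level avatar of the growth number; `Nat.card`,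
no hypothesis). [cite: GreenbergLNM1716, §1 pp. 60–65] [cite: Mazur1972, §6] -/
theorem natCard_selmerLayer_succ_eq_mul (n : ℕ) :
    Nat.card (W.selmerLayer κ (n + 1)) =
      Nat.card ↥(W.selmerLayer κ (n + 1) ⊓
          (W.conjH1 p (κ.layerSubgroup (n + 1)) (γ ^ p ^ n) - AddMonoidHom.id (W.subgroupH1 p (κ.layerSubgroup (n + 1)))).ker) *
        Nat.card ↥((W.selmerLayer κ (n + 1)).map
          (W.conjH1 p (κ.layerSubgroup (n + 1)) (γ ^ p ^ n) - AddMonoidHom.id (W.subgroupH1 p (κ.layerSubgroup (n + 1))))) :=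
  natCard_eq_natCard_inf_ker_mul_natCard_map _ _

/-- ★★ **`#Sel_n · #I_{n+1} ∣ #Sel_{n+1} · #(ker res ∩ Sel_n)`** for EVERY number field, prime, `ℤ_p`-extension and layer — the image `I_{n+1}` (which computes the
growth number, gen 57) is at most the layer ratio up to the restriction kernel (`≅ H¹(Gal(K_{n+1}/K_n), E(K_{n+1})[p^∞])`, killed by `p`). No hypothesis.
[cite: GreenbergLNM1716, §3 Lemmas 3.1–3.3] [cite: DokchitserDokchitserAnnals2010, Lemma 4.14 (proof)] -/
theorem natCard_selmerLayer_mul_dvd (hγ : κ.IsTopGenerator γ) (n : ℕ) :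
    Nat.card (W.selmerLayer κ n) *
        Nat.card ↥((W.selmerLayer κ (n + 1)).map
          (W.conjH1 p (κ.layerSubgroup (n + 1)) (γ ^ p ^ n) - AddMonoidHom.id (W.subgroupH1 p (κ.layerSubgroup (n + 1))))) ∣
      Nat.card (W.selmerLayer κ (n + 1)) *
        Nat.card ↥((W.resOfLe p (κ.layerSubgroup_antitone (Nat.le_succ n))).ker ⊓ W.selmerLayer κ n) := by
  rw [natCard_selmerLayer_eq_mul W κ n, natCard_selmerLayer_succ_eq_mul W κ (γ := γ) n]
  have h := natCard_map_resOfLe_selmerLayer_dvd W κ hγ n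
  calc Nat.card ↥((W.selmerLayer κ n).map (W.resOfLe p (κ.layerSubgroup_antitone (Nat.le_succ n)))) *
          Nat.card ↥((W.resOfLe p (κ.layerSubgroup_antitone (Nat.le_succ n))).ker ⊓ W.selmerLayer κ n) *
        Nat.card ↥((W.selmerLayer κ (n + 1)).map
          (W.conjH1 p (κ.layerSubgroup (n + 1)) (γ ^ p ^ n) - AddMonoidHom.id (W.subgroupH1 p (κ.layerSubgroup (n + 1)))))
      = Nat.card ↥((W.selmerLayer κ n).map (W.resOfLe p (κ.layerSubgroup_antitone (Nat.le_succ n)))) *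
          Nat.card ↥((W.selmerLayer κ (n + 1)).map
            (W.conjH1 p (κ.layerSubgroup (n + 1)) (γ ^ p ^ n) - AddMonoidHom.id (W.subgroupH1 p (κ.layerSubgroup (n + 1))))) *
        Nat.card ↥((W.resOfLe p (κ.layerSubgroup_antitone (Nat.le_succ n))).ker ⊓ W.selmerLayer κ n) := by ring
    _ ∣ _ := mul_dvd_mul_right (mul_dvd_mul_right h _) _

/-- ★★ **`#Sel_{n+1} ∣ #Sel_n · #I_{n+1} · #(Sel⁺_{n+1} ∩ H¹(K_{n+1}, E[p^∞])[p])`** for EVERY number field, prime, `ℤ_p`-extension and layer. No hypothesis.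
[cite: GreenbergLNM1716, §3 Lemmas 3.1–3.3] [cite: DokchitserDokchitserAnnals2010, Lemma 4.14 (proof)] -/
theorem natCard_selmerLayer_succ_dvd (hγ : κ.IsTopGenerator γ) (n : ℕ) :
    Nat.card (W.selmerLayer κ (n + 1)) ∣
      Nat.card (W.selmerLayer κ n) *
          Nat.card ↥((W.selmerLayer κ (n + 1)).map
            (W.conjH1 p (κ.layerSubgroup (n + 1)) (γ ^ p ^ n) - AddMonoidHom.id (W.subgroupH1 p (κ.layerSubgroup (n + 1))))) *
        Nat.card ↥(W.selmerLayer κ (n + 1) ⊓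
            (W.conjH1 p (κ.layerSubgroup (n + 1)) (γ ^ p ^ n) - AddMonoidHom.id (W.subgroupH1 p (κ.layerSubgroup (n + 1)))).ker ⊓
          AddSubgroup.torsionBy (W.subgroupH1 p (κ.layerSubgroup (n + 1))) p) := by
  rw [natCard_selmerLayer_succ_eq_mul W κ (γ := γ) n]
  have h1 := natCard_inf_ker_sub_dvd_mul W κ hγ n
  have h2 : Nat.card ↥((W.selmerLayer κ n).map (W.resOfLe p (κ.layerSubgroup_antitone (Nat.le_succ n)))) ∣ Nat.card (W.selmerLayer κ n) :=
    Dvd.intro _ (natCard_selmerLayer_eq_mul W κ n).symm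
  calc Nat.card ↥(W.selmerLayer κ (n + 1) ⊓
            (W.conjH1 p (κ.layerSubgroup (n + 1)) (γ ^ p ^ n) - AddMonoidHom.id (W.subgroupH1 p (κ.layerSubgroup (n + 1)))).ker) *
        Nat.card ↥((W.selmerLayer κ (n + 1)).map
          (W.conjH1 p (κ.layerSubgroup (n + 1)) (γ ^ p ^ n) - AddMonoidHom.id (W.subgroupH1 p (κ.layerSubgroup (n + 1)))))
      ∣ Nat.card (W.selmerLayer κ n) *
          Nat.card ↥(W.selmerLayer κ (n + 1) ⊓
              (W.conjH1 p (κ.layerSubgroup (n + 1)) (γ ^ p ^ n) - AddMonoidHom.id (W.subgroupH1 p (κ.layerSubgroup (n + 1)))).ker ⊓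
            AddSubgroup.torsionBy (W.subgroupH1 p (κ.layerSubgroup (n + 1))) p) *
        Nat.card ↥((W.selmerLayer κ (n + 1)).map
          (W.conjH1 p (κ.layerSubgroup (n + 1)) (γ ^ p ^ n) - AddMonoidHom.id (W.subgroupH1 p (κ.layerSubgroup (n + 1))))) :=
        mul_dvd_mul_right (h1.trans (mul_dvd_mul_right h2 _)) _
    _ = _ := by ring

/-! ## §3 The seed cell `E(K)[p] = 0`: the restriction is injective and the sandwich is sharp -/

omit [NumberField K] in
/-- `E(K)[p] = 0 ⟹ ker(res_{K_n→K_{n+1}}) = 0` (tree `resOfLe_layer_injective`: Greenberg's Lemma 3.1 with `E(K_∞)[p^∞] = 0`). [cite: GreenbergLNM1716, §3 Lemma 3.1] -/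
theorem ker_resOfLe_layer_eq_bot [NumberField K] [W.IsElliptic] (hK : ∀ P : W.toAffine.Point, p • P = 0 → P = 0) (n : ℕ) :
    (W.resOfLe p (κ.layerSubgroup_antitone (Nat.le_succ n))).ker = ⊥ :=
  (AddMonoidHom.ker_eq_bot_iff _).mpr (W.resOfLe_layer_injective κ hK (Nat.le_succ n))

/-- `E(K)[p] = 0 ⟹ #(ker res ∩ Sel_n) = 1`. [cite: GreenbergLNM1716, §3 Lemma 3.1] -/
theorem natCard_ker_resOfLe_inf_selmerLayer_eq_one [W.IsElliptic] (hK : ∀ P : W.toAffine.Point, p • P = 0 → P = 0) (n : ℕ) :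
    Nat.card ↥((W.resOfLe p (κ.layerSubgroup_antitone (Nat.le_succ n))).ker ⊓ W.selmerLayer κ n) = 1 := by
  rw [ker_resOfLe_layer_eq_bot W κ hK n, bot_inf_eq, AddSubgroup.card_bot]

/-- ★★★ **`E(K)[p] = 0`: `#Sel_n · #I_{n+1} ∣ #Sel_{n+1} ∣ #Sel_n · #I_{n+1} · #Sel⁺_{n+1}[p]`** for EVERY `ℤ_p`-extension of `K`, topological generator `γ` and layer `n` —
the finite-level avatar `#I_{n+1}` of the growth number (gen 57: `#I_{n+1} ∣ g_n ∣ #I_{n+1}·#ker g_{n+1}` on the cell) is the LAYER RATIO `#Sel_{n+1}/#Sel_n` up to the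
`p`-torsion of the plus part. [cite: GreenbergLNM1716, §3 Lemmas 3.1–3.3, §4 Lemma 4.3] [cite: DokchitserDokchitserAnnals2010, Lemma 4.14 (proof)] -/
theorem natCard_selmerLayer_mul_dvd_and_dvd_of_noTorsion [W.IsElliptic] (hK : ∀ P : W.toAffine.Point, p • P = 0 → P = 0)
    (hγ : κ.IsTopGenerator γ) (n : ℕ) :
    Nat.card (W.selmerLayer κ n) *
          Nat.card ↥((W.selmerLayer κ (n + 1)).map
            (W.conjH1 p (κ.layerSubgroup (n + 1)) (γ ^ p ^ n) - AddMonoidHom.id (W.subgroupH1 p (κ.layerSubgroup (n + 1))))) ∣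
        Nat.card (W.selmerLayer κ (n + 1)) ∧
      Nat.card (W.selmerLayer κ (n + 1)) ∣
        Nat.card (W.selmerLayer κ n) *
            Nat.card ↥((W.selmerLayer κ (n + 1)).map
              (W.conjH1 p (κ.layerSubgroup (n + 1)) (γ ^ p ^ n) - AddMonoidHom.id (W.subgroupH1 p (κ.layerSubgroup (n + 1))))) *
          Nat.card ↥(W.selmerLayer κ (n + 1) ⊓
              (W.conjH1 p (κ.layerSubgroup (n + 1)) (γ ^ p ^ n) - AddMonoidHom.id (W.subgroupH1 p (κ.layerSubgroup (n + 1)))).ker ⊓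
            AddSubgroup.torsionBy (W.subgroupH1 p (κ.layerSubgroup (n + 1))) p) := by
  refine ⟨?_, natCard_selmerLayer_succ_dvd W κ hγ n⟩
  have h := natCard_selmerLayer_mul_dvd W κ hγ n
  rw [natCard_ker_resOfLe_inf_selmerLayer_eq_one W κ hK n, mul_one] at h
  exact h

/-- ★★ THE RATIO DOOR THROUGH THE PLUS PART (seed cell `E(K)[p] = 0`, any datum with `X` finitely generated torsion):
**`0 < #Sel_{p^∞}(E/K_{n+1}) · #ker g_{n+1} < p^{pⁿ(p−1)} · #Sel_{p^∞}(E/K_n)` at SOME layer ⟹ `μ(X(E/K_∞)) = 0`** — gen 57's image door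
`0 < #I_{n+1}·#ker g_{n+1} < p^{pⁿ(p−1)}` fed by `#Sel_n · #I_{n+1} ∣ #Sel_{n+1}` (a sibling of gen 56's `…GrowthSelmer` §3, which goes through the limit invariants).
[cite: GreenbergLNM1716, Conj. 1.11, §3 Lemmas 3.1–3.3, §4 Lemma 4.3] [cite: Washington1997, §13.3 Thm. 13.13] -/
theorem mu_eq_zero_of_natCard_selmerLayer_succ_mul_kerG_lt_mul_of_noTorsion [W.IsElliptic] (hK : ∀ P : W.toAffine.Point, p • P = 0 → P = 0)
    (hγ : κ.IsTopGenerator γ) (D : W.SelmerDualData κ γ) [Module.Finite (IwasawaAlgebra p) D.X] (hD : D.IsTorsion) {n : ℕ}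
    (hpos : 0 < Nat.card (W.selmerLayer κ (n + 1)) * Nat.card (W.KerG κ (n + 1)))
    (hlt : Nat.card (W.selmerLayer κ (n + 1)) * Nat.card (W.KerG κ (n + 1)) < p ^ (p ^ n * (p - 1)) * Nat.card (W.selmerLayer κ n)) :
    D.mu = 0 := by
  obtain ⟨hsand, -⟩ := natCard_selmerLayer_mul_dvd_and_dvd_of_noTorsion W κ hK hγ n
  obtain ⟨hS1pos, hGpos⟩ := CanonicallyOrderedAdd.mul_pos.mp hpos
  have hprodpos := Nat.pos_of_dvd_of_pos hsand hS1pos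
  obtain ⟨hSnpos, hIpos⟩ := CanonicallyOrderedAdd.mul_pos.mp hprodpos
  have hle := Nat.le_of_dvd hS1pos hsand
  refine mu_eq_zero_of_natCard_map_selmerLayer_mul_kerG_lt W κ hγ D hD (Nat.mul_pos hIpos hGpos) ?_
  refine (lt_or_ge _ _).resolve_right fun hge ↦ ?_
  have h1 := Nat.mul_le_mul_right (Nat.card (W.KerG κ (n + 1))) hle
  have h2 := Nat.mul_le_mul_left (Nat.card (W.selmerLayer κ n)) hge
  have h3 : Nat.card (W.selmerLayer κ n) *
        (Nat.card ↥((W.selmerLayer κ (n + 1)).map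
            (W.conjH1 p (κ.layerSubgroup (n + 1)) (γ ^ p ^ n) - AddMonoidHom.id (W.subgroupH1 p (κ.layerSubgroup (n + 1))))) *
          Nat.card (W.KerG κ (n + 1))) < p ^ (p ^ n * (p - 1)) * Nat.card (W.selmerLayer κ n) := by
    rw [← mul_assoc]
    exact h1.trans_lt hlt
  rw [mul_comm (p ^ (p ^ n * (p - 1)))] at h3
  exact absurd (h2.trans_lt h3) (lt_irrefl _)

end Selmer

end Summit.BirchSwinnertonDyer.BirchSwinnertonDyer.Theorems.AlignedTransportAtTwoHalfDescentLayerIndexGrowthFiniteTwist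

end
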